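import Summits.AtomisticToContinuum.Crystallization.Theorems.PalmUnimodularRigidityLayeredLawsSelectHcpMinimiserEnclosure
import Summits.AtomisticToContinuum.Crystallization.Theorems.PalmUnimodularRigidityLayeredLawsSelectHcpRelaxedReference
import Summits.AtomisticToContinuum.Crystallization.Theorems.ExcessDecayLiouvilleCoarseGrainsHcpEnergySeries

/-!
# Crux `HcpLandscapeGap` (route HullExactificationCascade, stmt-AtomisticToContinuum-12087), line `birth`:
# stub P `stub_boxMinimiser` — the relaxed hcp box-minimiser exists

Registered stub `stub_boxMinimiser` of the checked skeleton `Cruxes/HcpLandscapeGap/Lines/birth.lean`: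
the Lennard-Jones energy per particle `e(a, h) = (hcpPeriodicConfiguration ha hh).energyPerParticle
lennardJones` of the relaxed hexagonal close packing attains its minimum over the (non-closed) box
`9/10 < a < 1`, `|h − a√(2/3)| ≤ a/100` at a point of the box.

Proof (bookkeeping on landed tree facts, all `[folklore]`):

* `PalmUnimodularRigidity.LayeredLawsSelectHcp.stub_relaxedReference`: the total energy function
  `hcpE` has a global minimiser `(a₀, h₀)` over the open quadrant, in the window
  `[189/200, 199/200] × [77/100, 163/200]`;
* `PalmUnimodularRigidity.LayeredLawsSelectHcp.tube_minimiserEnclosure`: any such minimiser has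
  `|a₀ − 0.97129| ≤ 10⁻⁴`, `|h₀ − 0.79294| ≤ 10⁻⁴`;
* `ExcessDecayLiouvilleCoarseGrains.hcpEnergySeries_of_eq` (third clause, `Q := hcpQ`):
  `e(a, h) = hcpE a h` for `a, h ≠ 0` (used inline; it is also the landed one-liner
  `SquareWellLayerCakeTwelveWithinOne.Closing.hcpE_eq_energyPerParticle`, whose module is not imported
  here to keep the import closure inside the hcp lattice-sum files);
* numerics: `0.8164 < √(2/3) < 0.8166`, so the enclosed point lies in the box, and every box point
  `(a', h')` has `0 < a'`, `0 < h'`, whence `e(a₀, h₀) = hcpE a₀ h₀ ≤ hcpE a' h' = e(a', h')`.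
-/

namespace Summit.AtomisticToContinuum.Crystallization.Theorems.HcpLandscapeGapBirth

open Literature.MathematicalPhysics.StatisticalMechanics
open Summit.AtomisticToContinuum.Crystallization.Theorems.PalmUnimodularRigidity.LayeredLawsSelectHcp
open Summit.AtomisticToContinuum.Crystallization.Theorems.ExcessDecayLiouvilleCoarseGrains

/-! ## Numerics of the box

The helpers live in the sub-namespace `BoxMinimiser` (no name clash with the sibling stub files of
the line). -/

namespace BoxMinimiser

/-- `0.8164 < √(2/3) < 0.8166`. [folklore] -/
theorem sqrt_two_thirds_bounds :
    (8164 / 10000 : ℝ) < Real.sqrt (2 / 3) ∧ Real.sqrt (2 / 3) < 8166 / 10000 :=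
  ⟨(Real.lt_sqrt (by norm_num)).2 (by norm_num), (Real.sqrt_lt' (by norm_num)).2 (by norm_num)⟩

/-- Every point of the box `9/10 < a < 1`, `|h − a√(2/3)| ≤ a/100` has `0 < a` and `0 < h`
(`h ≥ a(√(2/3) − 1/100) > 0`). [folklore] -/
theorem box_pos {a h : ℝ} (hbox : 9 / 10 < a ∧ a < 1 ∧ |h - a * Real.sqrt (2 / 3)| ≤ a / 100) :
    0 < a ∧ 0 < h := by
  obtain ⟨ha9, -, habs⟩ := hbox
  have ha : 0 < a := by linarith
  obtain ⟨hs1, -⟩ := sqrt_two_thirds_bounds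
  obtain ⟨hlo, -⟩ := abs_le.1 habs
  have h2 : a * (8164 / 10000) ≤ a * Real.sqrt (2 / 3) := mul_le_mul_of_nonneg_left hs1.le ha.le
  exact ⟨ha, by linarith⟩

/-- The enclosure `(0.97129, 0.79294) ± 10⁻⁴` of the relaxed reference lies in the box
`9/10 < a < 1`, `|h − a√(2/3)| ≤ a/100`. [folklore] -/
theorem enclosure_mem_box {a h : ℝ} (hea : |a - 97129 / 100000| ≤ 1 / 10000)
    (heh : |h - 79294 / 100000| ≤ 1 / 10000) :
    9 / 10 < a ∧ a < 1 ∧ |h - a * Real.sqrt (2 / 3)| ≤ a / 100 := by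
  obtain ⟨ha1, ha2⟩ := abs_le.1 hea
  obtain ⟨hh1, hh2⟩ := abs_le.1 heh
  have ha : 0 < a := by linarith
  obtain ⟨hs1, hs2⟩ := sqrt_two_thirds_bounds
  have h1 : a * Real.sqrt (2 / 3) ≤ a * (8166 / 10000) := mul_le_mul_of_nonneg_left hs2.le ha.le
  have h2 : a * (8164 / 10000) ≤ a * Real.sqrt (2 / 3) := mul_le_mul_of_nonneg_left hs1.le ha.le
  exact ⟨by linarith, by linarith, abs_le.2 ⟨by linarith, by linarith⟩⟩

end BoxMinimiser

/-! ## The statement -/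

open BoxMinimiser in
/-- **Stub P `stub_boxMinimiser` of line `birth` (crux `HcpLandscapeGap`, stmt-AtomisticToContinuum-12087):
THE RELAXED hcp BOX-MINIMISER EXISTS.** The Lennard-Jones energy per particle of
`hcpPeriodicConfiguration a h` attains its minimum over the box `9/10 < a < 1`, `|h − a√(2/3)| ≤ a/100`
at a point of the box: the global minimiser of `hcpE` on the open quadrant (`stub_relaxedReference`) is
enclosed at `(0.97129, 0.79294) ± 10⁻⁴` (`tube_minimiserEnclosure`), hence lies in the box, every box
point lies in the open quadrant, and `e(hcp a h) = hcpE a h` (`hcpEnergySeries_of_eq`). [folklore] -/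
theorem stub_boxMinimiser : ∃ a h : ℝ, ∃ ha : a ≠ 0, ∃ hh : h ≠ 0, (9 / 10 < a ∧ a < 1 ∧ |h - a * Real.sqrt (2 / 3)| ≤ a / 100) ∧ (∀ a' h' : ℝ, ∀ ha' : a' ≠ 0, ∀ hh' : h' ≠ 0, (9 / 10 < a' ∧ a' < 1 ∧ |h' - a' * Real.sqrt (2 / 3)| ≤ a' / 100) → (Literature.MathematicalPhysics.StatisticalMechanics.hcpPeriodicConfiguration ha hh).energyPerParticle Literature.MathematicalPhysics.StatisticalMechanics.lennardJones ≤ (Literature.MathematicalPhysics.StatisticalMechanics.hcpPeriodicConfiguration ha' hh').energyPerParticle Literature.MathematicalPhysics.StatisticalMechanics.lennardJones) := by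
  obtain ⟨a₀, h₀, ha₁, ha₂, hh₁, hh₂, hmin⟩ := stub_relaxedReference
  obtain ⟨hea, heh⟩ := tube_minimiserEnclosure a₀ h₀ ha₁ ha₂ hh₁ hh₂ hmin
  have ha0 : 0 < a₀ := by linarith
  have hh0 : 0 < h₀ := by linarith
  refine ⟨a₀, h₀, ha0.ne', hh0.ne', enclosure_mem_box hea heh, ?_⟩
  intro a' h' ha' hh' hbox'
  obtain ⟨hapos, hhpos⟩ := box_pos hbox'
  -- `e(hcp a h) = hcpE a h`: third clause of the landed `hcpEnergySeries_of_eq` with `Q := hcpQ` (the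
  -- one-liner of the landed `SquareWellLayerCakeTwelveWithinOne.Closing.hcpE_eq_energyPerParticle`,
  -- used inline to keep this stub's import closure inside the hcp lattice-sum files)
  calc (hcpPeriodicConfiguration ha0.ne' hh0.ne').energyPerParticle lennardJones
        = hcpE a₀ h₀ := (hcpEnergySeries_of_eq a₀ h₀ ha0.ne' hh0.ne' hcpQ rfl).2.2
    _ ≤ hcpE a' h' := hmin a' h' hapos hhpos
    _ = (hcpPeriodicConfiguration ha' hh').energyPerParticle lennardJones :=
        ((hcpEnergySeries_of_eq a' h' ha' hh' hcpQ rfl).2.2).symm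

end Summit.AtomisticToContinuum.Crystallization.Theorems.HcpLandscapeGapBirth
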